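import Summits.AtomisticToContinuum.HydrodynamicLimit.Theorems.CollisionIsometryCLTAdaptedWeightCLTBHCoarseningGermano

/-!
# Stub `stub_coarsening` (S6) of the line `block-h-dissipation-closure` for the crux `AdaptedWeightCLT`
(stmt-AtomisticToContinuum-14868, rev-12 TIME-LOCAL form; `--supports`), helper file: THE GERMANO INEQUALITY
INTEGRATED OVER THE BLOCK CENTRES (one configuration)

Integrating `Coarsening.defectC_le_germano` over `x ∈ 𝕋³`:
* the block average of cell defects integrates to the cell functional EXACTLY (`integral_conv_eq`: Fubini on
  `𝕋³ × 𝕋³` and the unit mass `∫ φ_N(x' − x) dx = 1`);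
* the kernel-variation indicators integrate to the Haar volume of a minimal-image ball,
  `∫ 𝟙[d(xᵢ, x) < R_N] dx = R_N³ |B₁|` (`integral_ite_euclidDist`, `R_N < 1/2`), and the smeared central moments
  are dominated by raw moments, `Σᵢ ∫ ψ_N(xᵢ − x') |vᵢ − ū_ψ(x')|^p dx' ≤ 2^p Σᵢ |vᵢ|^p` (Jensen for the cell
  averages, `sum_integral_wgt_pow_le`);
hence (`integral_defectC_le_germano`)

  `∫ₓ defectC φ w ≤ 4 ∫ₓ defectC ψ w + 144 ε_N² R_N³ |B₁| · 80 (N+1)⁻¹ Σᵢ (1 + |vᵢ|⁶) + 1260 ∫ₓ ethG · reyG`.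
-/

namespace Summit.AtomisticToContinuum.HydrodynamicLimit.Theorems.BlockHDissipation

open scoped BigOperators Topology Classical MeasureTheory ENNReal InnerProductSpace
open Filter Set MeasureTheory
open Literature.Analysis.FluidPDE Literature.Analysis.FluidPDE.Torus
open Summit.AtomisticToContinuum.HydrodynamicLimit.Theorems.ContactSourceDuhamel
open Summit.AtomisticToContinuum.HydrodynamicLimit.Theorems.ContactSourceDuhamel.TimeLocal
open Summit.AtomisticToContinuum.HydrodynamicLimit.Theorems.ContactBalance
open Summit.AtomisticToContinuum.HydrodynamicLimit.Theorems.SustainedAnisotropy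
open Literature.MathematicalPhysics.KineticTheory (hsDiameter localGibbsLaw empiricalDensityField
  empiricalMomentumField)

noncomputable section

namespace Coarsening

variable {N : ℕ} {γ C γc C' : ℝ} {φ ψ : ℕ → T3 → ℝ}

/-! ## The block average of cell defects integrates to the cell functional -/

/-- The crux integrand of a configuration is measurable in the centre and bounded. -/
theorem measurable_bdd_defectC (hadm : AdmissibleKernel γ C φ) (w : Cfg N) :
    Measurable (fun x => defectC N φ w x) ∧ ∃ B, ∀ x, |defectC N φ w x| ≤ B :=
  ⟨(EqRung.measurable_defectC_prod (hadm.1 N).continuous).of_uncurry_left,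
    ⟨_, fun x => defectC_le_of_vel (hadm.2.1 N) (hadm.2.2.2.2.1 N) w x
      (Finset.sum_nonneg fun j _ => norm_nonneg (w j).2) (norm_vel_le_sum w)⟩⟩

/-- The double integrand `(x, x') ↦ φ_N(x' − x) defectC ψ w x'` is integrable on `𝕋³ × 𝕋³`. -/
theorem integrable_conv_prod (hadm : AdmissibleKernel γ C φ) (hadmc : AdmissibleKernel γc C' ψ) (w : Cfg N) :
    Integrable (Function.uncurry fun x x' : T3 => φ N (x' - x) * defectC N ψ w x')
      ((volume : Measure T3).prod volume) := by
  obtain ⟨hm, B, hB⟩ := measurable_bdd_defectC hadmc w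
  have hφc : Continuous (φ N) := (hadm.1 N).continuous
  have hmeas : Measurable (Function.uncurry fun x x' : T3 => φ N (x' - x) * defectC N ψ w x') :=
    (hφc.measurable.comp (measurable_snd.sub measurable_fst)).mul (hm.comp measurable_snd)
  refine Integrable.of_bound hmeas.aestronglyMeasurable (C * ((N : ℝ) + 1) ^ (3 * γ) * B)
    (ae_of_all _ fun q => ?_)
  rw [Function.uncurry_def, Real.norm_eq_abs, abs_mul, abs_of_nonneg (hadm.2.1 N _)]
  exact mul_le_mul (hadm.2.2.2.2.1 N _) (hB _) (abs_nonneg _)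
    ((hadm.2.1 N 0).trans (hadm.2.2.2.2.1 N 0))

/-- **The block average of cell defects integrates to the cell functional**:
`∫ₓ ∫ φ_N(x' − x) defectC ψ w x' dx' dx = ∫ defectC ψ w x' dx'`. -/
theorem integral_conv_eq (hadm : AdmissibleKernel γ C φ) (hadmc : AdmissibleKernel γc C' ψ) (w : Cfg N) :
    ∫ x, ∫ x', φ N (x' - x) * defectC N ψ w x' = ∫ x', defectC N ψ w x' := by
  rw [integral_integral_swap (integrable_conv_prod hadm hadmc w)]
  refine integral_congr_ae (ae_of_all _ fun x' => ?_)
  change ∫ x, φ N (x' - x) * defectC N ψ w x' = _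
  rw [integral_mul_const, PastDamping.integral_comp_sub_left (φ N) x', hadm.2.2.1 N, one_mul]

/-! ## Indicators of minimal-image balls -/

/-- The indicator in `if`-form is the set indicator of a minimal-image ball. -/
theorem ite_euclidDist_eq_indicator (p : T3) (R : ℝ) :
    (fun x : T3 => if euclidDist p x < R then (1 : ℝ) else 0) = {x : T3 | euclidDist x p < R}.indicator 1 := by
  funext x
  simp only [Set.indicator_apply, Set.mem_setOf_eq, Pi.one_apply, euclidDist_comm p x]

/-- The indicator of a minimal-image ball is integrable. -/
theorem integrable_ite_euclidDist (p : T3) (R : ℝ) :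
    Integrable fun x : T3 => if euclidDist p x < R then (1 : ℝ) else 0 := by
  rw [ite_euclidDist_eq_indicator]
  exact (integrable_const (1 : ℝ)).indicator (PastDamping.measurableSet_euclidDist_lt p R)

/-- `∫ 𝟙[d(p, x) < R] dx = R³ |B₁|` for `0 < R < 1/2`. -/
theorem integral_ite_euclidDist (p : T3) {R : ℝ} (hR0 : 0 < R) (hR : R < 1 / 2) :
    ∫ x, (if euclidDist p x < R then (1 : ℝ) else 0) = R ^ 3 * PastDamping.ballVol := by
  rw [show (∫ x, (if euclidDist p x < R then (1 : ℝ) else 0)) =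
      ∫ x, {x : T3 | euclidDist x p < R}.indicator 1 x from by rw [← ite_euclidDist_eq_indicator],
    integral_indicator_one (PastDamping.measurableSet_euclidDist_lt p R)]
  exact PastDamping.volumeReal_euclidDist_lt p hR0 hR

/-! ## Smeared central moments against raw moments -/

/-- **Smeared central moments are dominated by raw moments**:
`Σᵢ ∫ ψ_N(xᵢ − x') |vᵢ − ū_ψ(x')|^p dx' ≤ 2^{p−1} · 2 Σᵢ |vᵢ|^p` (`|a − b|^p ≤ 2^{p−1}(|a|^p + |b|^p)`, unit
mass, and Jensen for the cell averages `(Σᵢ bᵢ) |ū_ψ|^p ≤ Σᵢ bᵢ |vᵢ|^p`). -/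
theorem sum_integral_wgt_pow_le (hadmc : AdmissibleKernel γc C' ψ) (w : Cfg N) (p : ℕ) :
    ∑ i : Fin (N + 1), ∫ x', wgtC N ψ w x' i * ‖(w i).2 - ubarC N ψ w x'‖ ^ p ≤
      2 ^ (p - 1) * (2 * ∑ i : Fin (N + 1), ‖(w i).2‖ ^ p) := by
  have hψc : Continuous (ψ N) := (hadmc.1 N).continuous
  have hψ0 := hadmc.2.1 N
  have hψ1 := hadmc.2.2.1 N
  have hIb : ∀ i, Integrable fun x' => wgtC N ψ w x' i :=
    fun i => PastDamping.integrable_of_continuous_T3 (hψc.comp (continuous_const.sub continuous_id))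
  have hIc : ∀ i, Integrable fun x' => wgtC N ψ w x' i * ‖ubarC N ψ w x'‖ ^ p := fun i =>
    integrable_wgt_mul hψc hψ0 w i (K := fun _ z => ‖z‖ ^ p) (by fun_prop)
  -- per particle
  have h1 : ∀ i, ∫ x', wgtC N ψ w x' i * ‖(w i).2 - ubarC N ψ w x'‖ ^ p ≤
      2 ^ (p - 1) * (‖(w i).2‖ ^ p + ∫ x', wgtC N ψ w x' i * ‖ubarC N ψ w x'‖ ^ p) := fun i => by
    calc _ ≤ ∫ x', (2 ^ (p - 1) * ‖(w i).2‖ ^ p * wgtC N ψ w x' i +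
          2 ^ (p - 1) * (wgtC N ψ w x' i * ‖ubarC N ψ w x'‖ ^ p)) := by
          refine integral_mono (integrable_wgt_mul hψc hψ0 w i (K := fun _ z => ‖(w i).2 - z‖ ^ p) (by fun_prop))
            (((hIb i).const_mul _).add ((hIc i).const_mul _)) fun x' => ?_
          have h := mul_le_mul_of_nonneg_left (CellUI.norm_sub_pow_le (w i).2 (ubarC N ψ w x') p)
            (show (0 : ℝ) ≤ wgtC N ψ w x' i from hψ0 _)
          exact h.trans_eq (by ring)
      _ = _ := by
          rw [integral_add ((hIb i).const_mul _) ((hIc i).const_mul _), integral_const_mul, integral_const_mul,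
            integral_wgtC_right hψ1 w i]
          ring
  -- Jensen, summed over the particles and integrated
  have h2 : ∑ i : Fin (N + 1), ∫ x', wgtC N ψ w x' i * ‖ubarC N ψ w x'‖ ^ p ≤ ∑ i : Fin (N + 1), ‖(w i).2‖ ^ p := by
    rw [← integral_finsetSum _ fun i _ => hIc i]
    calc _ ≤ ∫ x', ∑ i : Fin (N + 1), wgtC N ψ w x' i * ‖(w i).2‖ ^ p := by
          refine integral_mono (integrable_finsetSum _ fun i _ => hIc i)
            (integrable_finsetSum _ fun i _ => (hIb i).mul_const _) fun x' => ?_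
          have hJ := TimeZero.sum_mul_norm_avg_pow_le Finset.univ (fun i => (w i).2)
            (a := fun i => wgtC N ψ w x' i) (fun i _ => hψ0 _) p
          rw [← Pointwise.ubarC_eq, Finset.sum_mul] at hJ
          exact hJ
      _ = _ := by
          rw [integral_finsetSum _ fun i _ => (hIb i).mul_const _]
          exact Finset.sum_congr rfl fun i _ => by rw [integral_mul_const, integral_wgtC_right hψ1 w i, one_mul]
  calc _ ≤ ∑ i : Fin (N + 1), 2 ^ (p - 1) * (‖(w i).2‖ ^ p + ∫ x', wgtC N ψ w x' i * ‖ubarC N ψ w x'‖ ^ p) :=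
        Finset.sum_le_sum fun i _ => h1 i
    _ = 2 ^ (p - 1) * (∑ i : Fin (N + 1), ‖(w i).2‖ ^ p +
          ∑ i : Fin (N + 1), ∫ x', wgtC N ψ w x' i * ‖ubarC N ψ w x'‖ ^ p) := by
        rw [← Finset.mul_sum, Finset.sum_add_distrib]
    _ ≤ _ := by
        refine mul_le_mul_of_nonneg_left ?_ (by positivity)
        linarith

/-! ## The Germano inequality integrated over the centres -/

/-- **THE GERMANO INEQUALITY INTEGRATED OVER THE BLOCK CENTRES** (one configuration `w`, `R_N < 1/2`, the
Reynolds product integrable in the centre):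
`∫ₓ defectC φ ≤ 4 ∫ₓ defectC ψ + 144 ε_N² R_N³ |B₁| · 80 (N+1)⁻¹ Σᵢ (1 + |vᵢ|⁶) + 1260 ∫ₓ ethG · reyG`. -/
theorem integral_defectC_le_germano (hadm : AdmissibleKernel γ C φ) (hadmc : AdmissibleKernel γc C' ψ)
    (w : Cfg N) (hR0 : 0 < kvRad γ γc N) (hR : kvRad γ γc N < 1 / 2)
    (hI : Integrable fun x => ethG N φ ψ w x * reyG N φ ψ w x) :
    ∫ x, defectC N φ w x ≤ 4 * (∫ x', defectC N ψ w x') +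
      144 * (kvLip γ C γc N ^ 2 * (kvRad γ γc N ^ 3 * PastDamping.ballVol *
        (80 * (((N + 1 : ℕ) : ℝ)⁻¹ * ∑ i : Fin (N + 1), (1 + ‖(w i).2‖ ^ 6))))) +
      1260 * ∫ x, ethG N φ ψ w x * reyG N φ ψ w x := by
  have hψ0 := hadmc.2.1 N
  have hn : (0 : ℝ) ≤ ((N + 1 : ℕ) : ℝ)⁻¹ := by positivity
  set ε := kvLip γ C γc N with hε
  set R := kvRad γ γc N with hRdef
  -- the smeared moments and the two kernel-variation densities
  set M : ℕ → Fin (N + 1) → ℝ := fun p i => ∫ x', wgtC N ψ w x' i * ‖(w i).2 - ubarC N ψ w x'‖ ^ p with hM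
  have hM0 : ∀ p i, 0 ≤ M p i := fun p i => integral_nonneg fun x' => mul_nonneg (hψ0 _) (by positivity)
  have hIkv : ∀ p, Integrable fun x => ((N + 1 : ℕ) : ℝ)⁻¹ * ∑ i : Fin (N + 1),
      (if euclidDist (w i).1 x < R then (1 : ℝ) else 0) * M p i := fun p =>
    (integrable_finsetSum _ fun i _ => (integrable_ite_euclidDist _ _).mul_const _).const_mul _
  have hkv : ∀ p, ∫ x, ((N + 1 : ℕ) : ℝ)⁻¹ * ∑ i : Fin (N + 1),
      (if euclidDist (w i).1 x < R then (1 : ℝ) else 0) * M p i =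
      R ^ 3 * PastDamping.ballVol * (((N + 1 : ℕ) : ℝ)⁻¹ * ∑ i : Fin (N + 1), M p i) := fun p => by
    rw [integral_const_mul, integral_finsetSum _ fun i _ => (integrable_ite_euclidDist _ _).mul_const _]
    simp only [integral_mul_const, integral_ite_euclidDist _ hR0 hR, Finset.mul_sum]
    exact Finset.sum_congr rfl fun i _ => by ring
  -- integrate the pointwise inequality
  have hI1 : Integrable fun x => 4 * ∫ x', φ N (x' - x) * defectC N ψ w x' :=
    (integrable_conv_prod hadm hadmc w).integral_prod_left.const_mul 4
  have hI2 : Integrable fun x => 144 * (ε ^ 2 * (((N + 1 : ℕ) : ℝ)⁻¹ * ∑ i : Fin (N + 1),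
      (if euclidDist (w i).1 x < R then (1 : ℝ) else 0) * M 4 i)) := ((hIkv 4).const_mul _).const_mul 144
  have hI3 : Integrable fun x => 144 * (ε ^ 2 * (((N + 1 : ℕ) : ℝ)⁻¹ * ∑ i : Fin (N + 1),
      (if euclidDist (w i).1 x < R then (1 : ℝ) else 0) * M 6 i)) := ((hIkv 6).const_mul _).const_mul 144
  have hI4 : Integrable fun x => 1260 * (ethG N φ ψ w x * reyG N φ ψ w x) := hI.const_mul 1260
  have hI12 : Integrable fun x => 4 * (∫ x', φ N (x' - x) * defectC N ψ w x') +
      144 * (ε ^ 2 * (((N + 1 : ℕ) : ℝ)⁻¹ * ∑ i : Fin (N + 1),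
        (if euclidDist (w i).1 x < R then (1 : ℝ) else 0) * M 4 i)) := hI1.add hI2
  have hI123 : Integrable fun x => 4 * (∫ x', φ N (x' - x) * defectC N ψ w x') +
      144 * (ε ^ 2 * (((N + 1 : ℕ) : ℝ)⁻¹ * ∑ i : Fin (N + 1),
        (if euclidDist (w i).1 x < R then (1 : ℝ) else 0) * M 4 i)) +
      144 * (ε ^ 2 * (((N + 1 : ℕ) : ℝ)⁻¹ * ∑ i : Fin (N + 1),
        (if euclidDist (w i).1 x < R then (1 : ℝ) else 0) * M 6 i)) := hI12.add hI3
  have hmono : ∫ x, defectC N φ w x ≤ ∫ x, (4 * (∫ x', φ N (x' - x) * defectC N ψ w x') +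
      144 * (ε ^ 2 * (((N + 1 : ℕ) : ℝ)⁻¹ * ∑ i : Fin (N + 1),
        (if euclidDist (w i).1 x < R then (1 : ℝ) else 0) * M 4 i)) +
      144 * (ε ^ 2 * (((N + 1 : ℕ) : ℝ)⁻¹ * ∑ i : Fin (N + 1),
        (if euclidDist (w i).1 x < R then (1 : ℝ) else 0) * M 6 i)) +
      1260 * (ethG N φ ψ w x * reyG N φ ψ w x)) :=
    integral_mono (FreeStretch.integrable_defectC hadm w) (hI123.add hI4) fun x => defectC_le_germano hadm hadmc w x
  -- evaluate the right-hand side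
  have heval : ∫ x, (4 * (∫ x', φ N (x' - x) * defectC N ψ w x') +
      144 * (ε ^ 2 * (((N + 1 : ℕ) : ℝ)⁻¹ * ∑ i : Fin (N + 1),
        (if euclidDist (w i).1 x < R then (1 : ℝ) else 0) * M 4 i)) +
      144 * (ε ^ 2 * (((N + 1 : ℕ) : ℝ)⁻¹ * ∑ i : Fin (N + 1),
        (if euclidDist (w i).1 x < R then (1 : ℝ) else 0) * M 6 i)) +
      1260 * (ethG N φ ψ w x * reyG N φ ψ w x)) =
      4 * (∫ x', defectC N ψ w x') +
      144 * (ε ^ 2 * (R ^ 3 * PastDamping.ballVol * (((N + 1 : ℕ) : ℝ)⁻¹ * ∑ i : Fin (N + 1), M 4 i))) +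
      144 * (ε ^ 2 * (R ^ 3 * PastDamping.ballVol * (((N + 1 : ℕ) : ℝ)⁻¹ * ∑ i : Fin (N + 1), M 6 i))) +
      1260 * ∫ x, ethG N φ ψ w x * reyG N φ ψ w x := by
    rw [integral_add hI123 hI4, integral_add hI12 hI3, integral_add hI1 hI2, integral_const_mul 4,
      integral_const_mul 144, integral_const_mul (ε ^ 2), integral_const_mul 144, integral_const_mul (ε ^ 2),
      integral_const_mul 1260, integral_conv_eq hadm hadmc w, hkv 4, hkv 6]
  -- the moment bound `16 m₄ + 64 m₆ ≤ 80 (1 + m₆)`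
  have h4 := sum_integral_wgt_pow_le hadmc w 4
  have h6 := sum_integral_wgt_pow_le hadmc w 6
  have hmom : (((N + 1 : ℕ) : ℝ)⁻¹ * ∑ i : Fin (N + 1), M 4 i) + ((N + 1 : ℕ) : ℝ)⁻¹ * ∑ i : Fin (N + 1), M 6 i ≤
      80 * (((N + 1 : ℕ) : ℝ)⁻¹ * ∑ i : Fin (N + 1), (1 + ‖(w i).2‖ ^ 6)) := by
    have h46 : ∑ i : Fin (N + 1), ‖(w i).2‖ ^ 4 ≤ ∑ i : Fin (N + 1), (1 + ‖(w i).2‖ ^ 6) :=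
      Finset.sum_le_sum fun i _ => CellUI.pow_four_le_one_add_pow_six _
    have h66 : ∑ i : Fin (N + 1), ‖(w i).2‖ ^ 6 ≤ ∑ i : Fin (N + 1), (1 + ‖(w i).2‖ ^ 6) :=
      Finset.sum_le_sum fun i _ => by linarith
    rw [← mul_add, ← mul_assoc, mul_comm (80 : ℝ), mul_assoc]
    refine mul_le_mul_of_nonneg_left ?_ hn
    norm_num at h4 h6
    change ∑ i, M 4 i ≤ _ at h4
    change ∑ i, M 6 i ≤ _ at h6
    linarith
  have hK : 0 ≤ 144 * (ε ^ 2 * (R ^ 3 * PastDamping.ballVol)) :=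
    mul_nonneg (by norm_num) (mul_nonneg (sq_nonneg _) (mul_nonneg (pow_nonneg hR0.le 3) PastDamping.ballVol_nonneg))
  have hfin := mul_le_mul_of_nonneg_left hmom hK
  rw [heval] at hmono
  refine hmono.trans ?_
  nlinarith [hfin]

end Coarsening

/-- Registered anchor of this helper file (`--supports stmt-AtomisticToContinuum-14868`): the block average of cell
defects integrates to the cell functional (`Coarsening.integral_conv_eq`). -/
theorem bhCoarsening_integrated_anchor : ∀ (N : ℕ) (γ C γc C' : ℝ) (φ ψ : ℕ → T3 → ℝ) (w : Cfg N), AdmissibleKernel γ C φ → AdmissibleKernel γc C' ψ → ∫ x, ∫ x', φ N (x' - x) * defectC N ψ w x' = ∫ x', defectC N ψ w x' :=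
  fun _ _ _ _ _ _ _ w hadm hadmc => Coarsening.integral_conv_eq hadm hadmc w

end

end Summit.AtomisticToContinuum.HydrodynamicLimit.Theorems.BlockHDissipation
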